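import Literature.MathematicalPhysics.QuantumFieldTheory.Balaban1983to89.T3CurvGradLog
import HarnessLib

/-!
# `Balaban1983to89.T3CurvGradHolderRate` — rung R3, crux K1, child «MinimiserStabilityRegPr» (stmt-QuantumFields-19200): the log-Lipschitz stub V4′
# (`T3CurvGradLog.CritCurvGradLogAt`) IS [Balaban1985Variational] (9) FOR `β < 1` WITH THE ENDPOINT RATE `B₄(β) ≤ B₄/(1 − β)`, read at the T³ carrier
# (`CritCurvHolderRateAt`), BY NAME: `critCurvGradLogAt_of_holderRate`

Cell `ym3-torus` (HUMAN RULING D-0037, YM ladder rung R3), seat `ym3-torus-p1` gen 12; cell record HOME/UV3-NODE.md §21 (finding F-g12-1, located gap G-B11-F3′).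
WHAT THIS PINS.  Print states (9) «‖A‖_{1,β} < B₄(β₀)Mε₁(L^jη)^{−2−β} for 0 ≤ β ≤ β₀» with «B₄(β₀) depend[ing] on the indicated parameters also» (p. 279) and
derives it from [Balaban1985RegularSpaces] Thm 2 (1.36) (`β ≤ β₀ < 1`, constant `B₂(β₀)`, Prop. 3 p. 87: «B₀(β₀) on β₀ also»); the RATE at which `B₄(β₀)` degenerates
as `β₀ → 1` is not printed.  `CritCurvHolderRateAt L a₁ B₃ B₄` below is the carrier reading of (9) at the lattice pair `(x, x − ηe_ν)` for EVERY `β ∈ [0, 1)` with the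
Calderón–Zygmund rate `B₄/(1 − β)`: `‖(D^{1*}_{U,ν}F_{κκ′})(x)‖ < (B₄/(1−β))·ε₁·η^{2+β}`, `η = L^{−(K−n)}`.  Optimising `β = 1 − 1/((K − n)·log L + 1)` gives the
log-Lipschitz form with `B₄′ = e·B₄·log L` (`critCurvGradLogAt_of_holderRate`), so the v6 stub `stub_critCurvGradLog` follows from print's (9) for `β < 1` plus
ONE located constant-tracking statement about [Balaban1985RegularSpaces] Thm 2 (the rate), at the carrier.  Hypothesis schema, never asserted; the bridge is
kernel-checked real analysis.

References: T. Bałaban, CMP 102 (1985) 277–309 [Balaban1985Variational] (Thm 1 (9) p.279, Sect. F (152) p.301); CMP 99 (1985) 75–102 [Balaban1985RegularSpaces]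
(Thm 2 (1.36) p.82, Prop. 3 p.87).
-/

noncomputable section

open MeasureTheory Filter Topology
open scoped Matrix.Norms.L2Operator
open Literature.MathematicalPhysics.QuantumFieldTheory.Balaban1983to89.T3ContinuumYM3Torus
open Literature.MathematicalPhysics.QuantumFieldTheory.Balaban1983to89.T3UnitLawDensityEML (ℰp measurableE_ℰp)
open Literature.MathematicalPhysics.QuantumFieldTheory.Balaban1983to89.T3UnitScaleTilt
open Literature.MathematicalPhysics.QuantumFieldTheory.Balaban1983to89.T3TiltDescent
open Literature.MathematicalPhysics.QuantumFieldTheory.Balaban1983to89.T3CruxEstimates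
open Literature.MathematicalPhysics.QuantumFieldTheory.Balaban1983to89.T3ConstrainedMinimiser
open Literature.MathematicalPhysics.QuantumFieldTheory.Balaban1983to89.T3DescentFibreTower
open Literature.MathematicalPhysics.QuantumFieldTheory.Balaban1983to89.T3RegularMinimiser
open Literature.MathematicalPhysics.QuantumFieldTheory.Balaban1983to89.T3PrintedRegularMinimiser
open Literature.MathematicalPhysics.QuantumFieldTheory.Balaban1983to89.T3LowerAlongMinimisersSplit
open Literature.MathematicalPhysics.QuantumFieldTheory.Balaban1983to89.T3CurvGradLog
open Literature.MathematicalPhysics.QuantumFieldTheory.Balaban1983to89.B10Eq27TorusAxialLog (toUField unitsField)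
open Literature.MathematicalPhysics.QuantumFieldTheory.Balaban1983to89.B10Eq68TorusRegularity (plaqFT covDerivT covDivT)
open Literature.MathematicalPhysics.QuantumFieldTheory.Balaban1983to89.Missing

namespace Literature.MathematicalPhysics.QuantumFieldTheory.Balaban1983to89.T3CurvGradHolderRate

/-! ## §1 (9) for every `β < 1` with the endpoint rate, at the carrier -/

section Schema

/-- **[Balaban1985Variational] (9) FOR `0 ≤ β < 1` WITH RATE `B₄/(1 − β)`, READ AT THE T³ CARRIER FOR CRITICAL CONFIGURATIONS IN (8)** (hypothesis schema, never
asserted): at the lattice pair `(x, x − ηe_ν)` the `β`-Hölder clause of (9) bounds the backward covariant derivative of every plaquette field of an (8)-regular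
critical `U` (reading R2) by `(B₄/(1−β))·ε₁·η^{2+β}`, `η = L^{−(K−n)}`, for EVERY `β ∈ [0, 1)` — the source [Balaban1985RegularSpaces] Thm 2 (1.36) is stated for
`β ≤ β₀ < 1` with a constant `B₂(β₀)` whose growth as `β₀ → 1` print leaves implicit; the rate `(1 − β)⁻¹` is the standard endpoint behaviour of the elliptic
estimate behind it (located constant-tracking, G-B11-F3′). [cite: Balaban1985Variational, Thm 1 (9) p.279; Balaban1985RegularSpaces, Thm 2 (1.36) p.82 and Prop. 3 p.87] -/
def CritCurvHolderRateAt (L : ℕ) (a₁ B₃ B₄ : ℝ) : Prop :=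
  ∀ F : T3Family, F.L = L → ∀ (n K : ℕ) (hnK : n < K) (ε₁ : ℝ), 0 < ε₁ → ε₁ ≤ a₁ →
    ∀ V : GaugeField (F.P n) 0 (Matrix.specialUnitaryGroup (Fin 2) ℂ), PlaqSmall ε₁ V →
      ∀ U : GaugeField (F.P K) 0 (Matrix.specialUnitaryGroup (Fin 2) ℂ), RegPr F n K (B₃ * ε₁) U → U ∈ fibre F ℰp n K hnK.le V →
        (∃ e : ℝ, 0 < e ∧ U ∈ regFibrePr F n K hnK.le e V ∧
          IsMinOn (fun W : GaugeField (F.P K) 0 (Matrix.specialUnitaryGroup (Fin 2) ℂ) => wilsonAction4 W) (regFibrePr F n K hnK.le e V) U) →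
          ∀ β : ℝ, 0 ≤ β → β < 1 →
            ∀ (x : Site (F.P K) 0) (ν κ κ' : Fin (F.P K).d), κ ≠ κ' →
              ‖covDerivT 1 (unitsField (toUField U)) ν (plaqFT (unitsField (toUField U)) κ κ') x‖ <
                B₄ / (1 - β) * ε₁ * ((F.L : ℝ)⁻¹) ^ ((2 + β) * ((K - n : ℕ) : ℝ))

end Schema

/-! ## §2 The optimisation in `β`: rate form ⇒ log-Lipschitz form -/

section Bridge

/-- Members of the family have block size `L ≥ 3` (odd and `> 1`), so `1 ≤ log L`. [cite: Balaban1985UV3, (1)-(3) p.256] -/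
theorem one_le_log_L (F : T3Family) : 1 ≤ Real.log (F.L : ℝ) := by
  have h3 : (3 : ℝ) ≤ F.L := by
    have hodd := F.hL.1
    have h1 := F.hL.2
    have : 3 ≤ F.L := by
      rcases hodd with ⟨j, hj⟩
      omega
    exact_mod_cast this
  have he : Real.exp 1 ≤ (F.L : ℝ) := le_trans (le_of_lt (lt_trans Real.exp_one_lt_d9 (by norm_num))) h3
  calc (1 : ℝ) = Real.log (Real.exp 1) := (Real.log_exp 1).symm
    _ ≤ Real.log (F.L : ℝ) := Real.log_le_log (Real.exp_pos 1) he

/-- **THE `β`-OPTIMISATION** (real analysis): for `x = L⁻¹` with `log L ≥ 1`, `k ≥ 1` and `β := 1 − 1/(k·log L + 1)`: `0 ≤ β < 1`,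
`1/(1 − β) = k·log L + 1 ≤ (k + 1)·log L`, and `x^{(2+β)k} ≤ e·x^{3k}` (`x^{(β−1)k} = L^{k/(k log L + 1)} = e^{k log L/(k log L + 1)} ≤ e`).
[cite: Balaban1985RegularSpaces, Thm 2 (1.36) p.82] -/
theorem rate_bound_at_optimal_beta {Lr B₄ ε₁ : ℝ} (hL : 1 ≤ Real.log Lr) (hLpos : 0 < Lr) (hB₄ : 0 ≤ B₄) (hε₁ : 0 ≤ ε₁) {k : ℕ} (hk : 1 ≤ k) :
    let β : ℝ := 1 - 1 / ((k : ℝ) * Real.log Lr + 1)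
    0 ≤ β ∧ β < 1 ∧
      B₄ / (1 - β) * ε₁ * (Lr⁻¹) ^ ((2 + β) * (k : ℝ)) ≤ Real.exp 1 * B₄ * Real.log Lr * ε₁ * ((k : ℝ) + 1) * (Lr⁻¹) ^ (3 * k) := by
  intro β
  have hk1 : (1 : ℝ) ≤ (k : ℝ) := by exact_mod_cast hk
  set D : ℝ := (k : ℝ) * Real.log Lr + 1 with hD_def
  have hD1 : 1 ≤ D := by rw [hD_def]; nlinarith
  have hD : 0 < D := by linarith
  have hβ_def : β = 1 - 1 / D := rfl
  have hβ0 : 0 ≤ β := by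
    rw [hβ_def, sub_nonneg, div_le_iff₀ hD]; linarith
  have hβ1 : β < 1 := by
    rw [hβ_def]; have : 0 < 1 / D := by positivity
    linarith
  have h1β : 1 - β = 1 / D := by rw [hβ_def]; ring
  refine ⟨hβ0, hβ1, ?_⟩
  -- `B₄/(1−β) = B₄·D ≤ B₄·(k+1)·log L`
  have hfac : B₄ / (1 - β) = B₄ * D := by rw [h1β]; field_simp
  have hDle : D ≤ ((k : ℝ) + 1) * Real.log Lr := by rw [hD_def]; nlinarith
  -- `x^{(2+β)k} ≤ e·x^{3k}`
  have hx : 0 < Lr⁻¹ := inv_pos.mpr hLpos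
  have hlogx : Real.log Lr⁻¹ = -Real.log Lr := Real.log_inv Lr
  have hpow : (Lr⁻¹) ^ ((2 + β) * (k : ℝ)) ≤ Real.exp 1 * (Lr⁻¹) ^ (3 * k) := by
    rw [Real.rpow_def_of_pos hx, hlogx]
    have h3k : (Lr⁻¹) ^ (3 * k) = Real.exp (-Real.log Lr * (3 * (k : ℝ))) := by
      rw [← Real.rpow_natCast, Real.rpow_def_of_pos hx, hlogx]; push_cast; ring_nf
    rw [h3k, ← Real.exp_add]
    apply Real.exp_le_exp.mpr
    -- `−log L·(2+β)k ≤ 1 − 3k·log L` ⟺ `(1−β)·k·log L ≤ 1`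
    have hkey : (1 - β) * ((k : ℝ) * Real.log Lr) ≤ 1 := by
      rw [h1β, one_div, inv_mul_le_iff₀ hD, hD_def]; linarith
    nlinarith [hkey]
  calc B₄ / (1 - β) * ε₁ * (Lr⁻¹) ^ ((2 + β) * (k : ℝ))
      = B₄ * D * ε₁ * (Lr⁻¹) ^ ((2 + β) * (k : ℝ)) := by rw [hfac]
    _ ≤ B₄ * (((k : ℝ) + 1) * Real.log Lr) * ε₁ * (Real.exp 1 * (Lr⁻¹) ^ (3 * k)) := by
        apply mul_le_mul _ hpow (Real.rpow_nonneg hx.le _) (by positivity)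
        exact mul_le_mul_of_nonneg_right (mul_le_mul_of_nonneg_left hDle hB₄) hε₁
    _ = Real.exp 1 * B₄ * Real.log Lr * ε₁ * ((k : ℝ) + 1) * (Lr⁻¹) ^ (3 * k) := by ring

/-- **V4′ ⇐ (9) FOR `β < 1` WITH RATE** (the bridge): `CritCurvHolderRateAt L a₁ B₃ B₄ → CritCurvGradLogAt L a₁ B₃ (e·B₄·log L)` (`B₄ ≥ 0`) — at a member with
`k = K − n ≥ 1` steps choose `β = 1 − 1/(k log L + 1)`; the rate bound `(B₄/(1−β))ε₁L^{−(2+β)k}` is at most `e·B₄·log L·ε₁·(k+1)·L^{−3k}`.  So the v6 stub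
`stub_critCurvGradLog` of stmt-QuantumFields-19200 is print's (9) for `β < 1` plus the located endpoint rate of [Balaban1985RegularSpaces] Thm 2, BY NAME.
[cite: Balaban1985Variational, Thm 1 (9) p.279; Balaban1985RegularSpaces, Thm 2 (1.36) p.82] -/
theorem critCurvGradLogAt_of_holderRate {L : ℕ} {a₁ B₃ B₄ : ℝ} (hB₄ : 0 ≤ B₄) (h : CritCurvHolderRateAt L a₁ B₃ B₄) :
    CritCurvGradLogAt L a₁ B₃ (Real.exp 1 * B₄ * Real.log (L : ℝ)) := by
  intro F hF n K hnK ε₁ hε₁ hε₁a V hV U hU8 hUB hcrit x ν κ κ' hne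
  have hk : 1 ≤ K - n := by omega
  have hlog : 1 ≤ Real.log (F.L : ℝ) := one_le_log_L F
  have hLpos : (0 : ℝ) < F.L := L_cast_pos F
  obtain ⟨hβ0, hβ1, hbound⟩ := rate_bound_at_optimal_beta (B₄ := B₄) (ε₁ := ε₁) hlog hLpos hB₄ hε₁.le hk
  have hlt := h F hF n K hnK ε₁ hε₁ hε₁a V hV U hU8 hUB hcrit _ hβ0 hβ1 x ν κ κ' hne
  refine hlt.trans_le (hbound.trans_eq ?_)
  rw [hF]

end Bridge

end Literature.MathematicalPhysics.QuantumFieldTheory.Balaban1983to89.T3CurvGradHolderRate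

end
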